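import Mathlib.Analysis.CStarAlgebra.Unitary.Connected
import Literature.MathematicalPhysics.QuantumFieldTheory.Balaban1983to89.B9Eq17RegimeBallZd
import Literature.MathematicalPhysics.QuantumFieldTheory.Balaban1983to89.B9Eq336PureGaugeOrbitZd

/-!
# `Balaban1983to89.B9Thm311SmallFieldPathZd` — [Balaban1985BackgroundPropagators] Thm 3.11 p. 416 ∕ (3.36) p. 396 AT THE `ℤᵈ × 𝔸` CARRIER: THE UNIFORM
# SMALL-FIELD BALL AROUND THE FLAT BACKGROUND, AND ITS GAUGE TRANSLATE AROUND EVERY PURE GAUGE `1^w`, ARE PATH CONNECTED INSIDE THE REGIME `𝒰′` — by the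
# RADIAL UNITARY PATH `t ↦ e^{it·arg U(b)}` along which NO bond variable moves away from `1` and every plaquette variable stays `4δ`-close to `1`

statement-level skeleton of published theorems with citation tags; proofs where landed; nothing here is a claim about the
Yang–Mills mass gap

T. Bałaban, *Propagators for lattice gauge theories in a background field*, Commun. Math. Phys. **99** (1985) 389–434 [`Balaban1985BackgroundPropagators`,
"B9"], journal page = PDF page + 388.  THE PRINT (verbatim).  p. 396: *«there exists a gauge transformation u defined on □ … such that U^u = e^{iηA} and
|A| < O(1)Mα₀ (3.36)»* — the regularity class is, cube by cube and modulo gauge, a uniform ball of bond variables around `1`; p. 416, Theorem 3.11 and its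
proof: *«In [4] we have proved that the operator G_□(1) is positive»*, the curved case following by perturbation along the class.  T. Bałaban, *Averaging
operations for lattice gauge theories*, CMP **98** (1985) 17–51 [`Balaban1985Averaging`] (22)–(25) p. 21: `log U = iA`, `A` hermitian, `|A| ≤ π`,
`|U − 1| ≤ |log U| ≤ (π∕2)|U − 1|`.  PDF held: `paper:balaban1985-cmp99-background-propagators` pp. 396, 416 (re-read by this seat 2026-08-28).

CITATION HEADER ∕ WHY THIS FILE (cell `pub-ymgap`, HUMAN RULING D-0062 ∕ D-0149; width seat `pub-ymgap-dag-n06-w3` (g4), node N06 = [B9]; CLAIM-1; count-neutral).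
dag-n06-w4 g3's continuity-method reduction `B9Thm311ContinuityMethodZd` (p614111) converts «Theorem 3.11 uniformly on the regime» into two displayed inputs:
(a) a uniform coercivity constant at the positive points (print's (3.115)), (b) a PRECONNECTED family `S ⊆ 𝒰′ ∋ 1` of backgrounds; its own A6 inhabits (b)
with the singleton `S = {1}`.  THIS FILE supplies the non-trivial families: every uniform ball `{U unitary, sup_b ‖U(b) − 1‖ < δ}` (inside `𝒰′` when
`4δ < (α_Q∕L²)L^{−2m}`, dag-n06-w2's `B9Eq17RegimeBallZd.ball_subset_reg17UnivP`) and every gauge translate of it around a pure gauge `1^w` is PATH CONNECTED, hence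
preconnected — via the one-bond engine of Mathlib's `Analysis/CStarAlgebra/Unitary/Connected` (J. Loreaux 2025: `Unitary.argSelfAdjoint`,
`expUnitary_argSelfAdjoint`, `Unitary.norm_expUnitary_smul_argSelfAdjoint_sub_one_le`), read on the units `𝔸ˣ` and lifted bond by bond to the product topology.
The companion `B9Thm311SmallFieldPathZdContinuity` RUNS the reduction on these families.  INPUTS BY NAME: Mathlib (above; `JoinedIn.ofLine`, `IsPathConnected.image`),
this lineage's `MatrixLog` ((24)–(25)), dag-n06-w2 g3 `B9Eq17RegimeBallZd` (`norm_plaqF_sub_one_le`, `reg17Univ_of_bond_close`, `ball_subset_reg17UnivP`), this seat's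
g3 files `B9Eq336PureGaugeOrbitZd.continuous_gaugeAct`, `B9Eq333ProjectionCovarianceZd.gaugeAct_inv_gaugeAct`, `B9Eq332AveragingLetterCovarianceZd.reg17_gaugeAct_iff`.

WHAT IS DECLARED ∕ PROVED (kernel, 0 sorry; three small definitions with body — `argSA`, `bondPath`, `cfgPath` — and theorems; no `instance`, no `notation`).
* §1 (one bond, any unital C⋆-algebra `𝔸`) `argSA u` (def: `cfc arg` of a unit's value; `argSA_eq`: = `Unitary.argSelfAdjoint` on a unitary-valued unit),
  `norm_argSA_le_pi`, `norm_argSA_le` ((25): `≤ (π∕2)‖u − 1‖`), `bondPath u t` (def: the unit `e^{it·arg u}`), `val_bondPath ∕ val_inv_bondPath`,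
  `bondPath_mem_unitaryUnits`, `bondPath_zero ∕ bondPath_one` (`‖u − 1‖ < 2`), `continuous_bondPath`, ★ `norm_bondPath_sub_one_le` (`t ∈ [0,1]`:
  `‖e^{it·arg u} − 1‖ ≤ ‖u − 1‖`, SHARP), `norm_bondPath_sub_one_le_mul(')` ((24)–(25): `≤ |t|·‖arg u‖ ≤ |t|(π∕2)‖u − 1‖`).
* §2 (backgrounds on `ℤᵈ`, product topology) `cfgPath U t` (def, bondwise), `cfgPath_apply ∕ _zero ∕ _one ∕ _mem_unitaryUnits`, `continuous_cfgPath`,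
  ★ `norm_cfgPath_sub_one_le`, ★ `norm_plaqF_cfgPath_sub_one_le` (every plaquette `4ε`-close along the whole path), `reg17Univ_cfgPath` (the path lies in the
  class (1.7) on `ℤᵈ` once `4ε < αL^{−2m}`).
* §3 `one_mem_ball`, ★ `cfgPath_mem_ball` (the radial path of a point of the `δ`-ball stays in the `δ`-ball, `δ ≤ 2`), ★★ `joinedIn_ball_one`,
  ★★ `isPathConnected_ball` (`0 < δ ≤ 2`), `isPreconnected_ball`, ★ `isPathConnected_closedBall` (`0 ≤ δ < 2`; dag-n06-w4 g4's compact class).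
* §4 (gauge translates) `mem_gaugeAct_image_iff`, `gaugeAct_cfgPath_zero ∕ _one`, `continuous_gaugeAct_cfgPath`, `norm_plaqF_gaugeAct_cfgPath_sub_one_le`,
  `gaugeAct_one_mem_image_ball`, `gaugeAct_mem_image_ball`, ★★ `joinedIn_image_ball_gaugeAct_one` (every point of the translated ball is joined to the pure
  gauge `1^w` inside it), ★★ `isPathConnected_image_ball`, `isPreconnected_image_ball`, ★★ `image_ball_subset_reg17UnivP` (the translated ball lies in `𝒰′`).

HONEST SCOPE ∕ LOCATED.  C⋆-kinematics from Mathlib + point-set topology; constants explicit (`1`, `4`, `π∕2`) but NO estimate of [B9]; Theorem 3.11 at curved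
`U₀` is NOT proved here.  The displayed input (b) for `𝒰′` ITSELF («the regime set is preconnected») is NOT proved and NOT claimed: the radial path controls
plaquettes only through bonds (`4ε`); a plaquette-small background on `ℤᵈ` need not be bond-small in ANY gauge (constant abelian curvature: axial-gauge bond
variables grow linearly with the distance), so the balls and their translates do not exhaust `𝒰′`; in the abelian case a cohomological lift (`6α < 2π` ⟹ the
real plaquette angles are an exact cocycle `θ = da`, straight path `e^{ita} ⊆ 𝒰′`) would close (b), the non-abelian `d ≥ 3` analogue (Bianchi-constrained
plaquettes) is open here.  Count-neutral helper; N05 ∕ N06 NOT discharged; K1⁸ `stmt-QuantumFields-26907` NOT closed (K1⁷ 20542 aside); one finite `𝕋⁴`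
programme at fixed `ε`, Bałaban as printed; R4 closes only the conditional finite-`𝕋⁴` rung `BalabanLadder.UV` — nothing continuum ∕ ℝ⁴ ∕ OS ∕ mass gap ∕ Clay.
Unit `pub-ymgap-dag-n06-w3` (g4), 2026-08-28.
-/

noncomputable section

namespace Literature.MathematicalPhysics.QuantumFieldTheory.Balaban1983to89.B9Thm311SmallFieldPathZd

open scoped Topology Real
open Filter Complex
open B7Prop1Explicit
open B7Prop2Explicit (unitaryUnits mem_unitaryUnits unitaryUnits_le_U1)
open B7Eq78Linearization (conjR conjR_sub conjR_one)
open B8Ineq132 (plaqF plaqF_gaugeAct norm_conjR)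
open B9Eq316AveragingTransposeZd (Reg17 alphaQ alphaQ_pos)
open B9Eq17RegimeBallZd (norm_plaqF_sub_one_le ball_subset_reg17UnivP reg17Univ_of_bond_close)

-- `Site` alone could resolve to the torus sites of `Setup.lean`; re-export the `ℤ^d` sites of `B7Prop1Explicit`.
export B7Prop1Explicit (Site)

variable {𝔸 : Type*} [CStarAlgebra 𝔸]

/-! ## §1  One bond: the radial unitary path `t ↦ e^{it·arg u}` of a unital C⋆-algebra (Mathlib) read on the units `𝔸ˣ` -/

section OneBond

/-- `arg u` for a unit `u` of a unital C⋆-algebra: the self-adjoint `cfc arg u` (principal branch through the continuous functional calculus) — Mathlib's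
`Unitary.argSelfAdjoint`, read on `𝔸ˣ` so that no membership proof enters the term (`argSA_eq`: for a unitary-valued unit it IS `Unitary.argSelfAdjoint`).
[cite: Balaban1985Averaging, (22)–(23) p.21 («log U = iA, A hermitian, |A| ≤ π»)] -/
def argSA (u : 𝔸ˣ) : selfAdjoint 𝔸 :=
  ⟨cfc (arg · : ℂ → ℂ) (u : 𝔸), .cfc_arg (u : 𝔸)⟩

/-- `argSA` IS Mathlib's `Unitary.argSelfAdjoint` on a unitary-valued unit. [cite: Balaban1985Averaging, (23) p.21] -/
theorem argSA_eq {u : 𝔸ˣ} (hu : u ∈ unitaryUnits 𝔸) : argSA u = Unitary.argSelfAdjoint ⟨(u : 𝔸), hu⟩ := rfl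

/-- `‖arg u‖ ≤ π`. [cite: Balaban1985Averaging, (23) p.21 («|A| ≤ π»)] -/
theorem norm_argSA_le_pi (u : 𝔸ˣ) : ‖argSA u‖ ≤ π :=
  norm_cfc_le (by positivity) fun y _ => by simpa using abs_arg_le_pi y

/-- `‖arg u‖ ≤ (π∕2)‖u − 1‖` for a unitary-valued unit with `‖u − 1‖ < 2`. [cite: Balaban1985Averaging, (25) p.21] -/
theorem norm_argSA_le {u : 𝔸ˣ} (hu : u ∈ unitaryUnits 𝔸) (h2 : ‖(u : 𝔸) - 1‖ < 2) : ‖argSA u‖ ≤ π / 2 * ‖(u : 𝔸) - 1‖ := by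
  rw [argSA_eq hu]
  exact MatrixLog.unitary_norm_arg_le (u := ⟨(u : 𝔸), hu⟩) h2

/-- **THE RADIAL PATH OF ONE BOND VARIABLE**: `t ↦ e^{it·arg u}` as a unit (`Unitary.toUnits ∘ selfAdjoint.expUnitary`). [cite: Balaban1985BackgroundPropagators, (3.36) p.396 («U^u = e^{iηA}»); Balaban1985Averaging, (22)–(23) p.21] -/
def bondPath (u : 𝔸ˣ) (t : ℝ) : 𝔸ˣ :=
  Unitary.toUnits (selfAdjoint.expUnitary (t • argSA u))

/-- the value of the radial path. [cite: Balaban1985Averaging, (22) p.21 (bookkeeping)] -/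
theorem val_bondPath (u : 𝔸ˣ) (t : ℝ) : ((bondPath u t : 𝔸ˣ) : 𝔸) = ((selfAdjoint.expUnitary (t • argSA u) : unitary 𝔸) : 𝔸) := rfl

/-- the inverse along the radial path is the adjoint. [cite: Balaban1985Averaging, (22) p.21 (bookkeeping)] -/
theorem val_inv_bondPath (u : 𝔸ˣ) (t : ℝ) :
    (((bondPath u t)⁻¹ : 𝔸ˣ) : 𝔸) = star ((selfAdjoint.expUnitary (t • argSA u) : unitary 𝔸) : 𝔸) := rfl

/-- the radial path is unitary-valued at every time, for EVERY unit `u`. [cite: Balaban1985Averaging, (22)–(23) p.21] -/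
theorem bondPath_mem_unitaryUnits (u : 𝔸ˣ) (t : ℝ) : bondPath u t ∈ unitaryUnits 𝔸 :=
  (selfAdjoint.expUnitary (t • argSA u)).2

/-- it starts at `1`. [cite: Balaban1985Averaging, (22) p.21 (bookkeeping)] -/
theorem bondPath_zero (u : 𝔸ˣ) : bondPath u 0 = 1 := by
  apply Units.ext
  rw [val_bondPath, zero_smul, selfAdjoint.expUnitary_zero, Units.val_one, OneMemClass.coe_one]

/-- it ends at `u` when `u` is unitary with `‖u − 1‖ < 2` (`e^{i arg u} = u`, Mathlib's `expUnitary_argSelfAdjoint`). [cite: Balaban1985Averaging, (22)–(23) p.21] -/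
theorem bondPath_one {u : 𝔸ˣ} (hu : u ∈ unitaryUnits 𝔸) (h2 : ‖(u : 𝔸) - 1‖ < 2) : bondPath u 1 = u := by
  apply Units.ext
  rw [val_bondPath, one_smul, argSA_eq hu, expUnitary_argSelfAdjoint (u := ⟨(u : 𝔸), hu⟩) h2]

/-- the radial path is continuous in `t` (topology of `𝔸ˣ`). [cite: Balaban1985Averaging, (22) p.21 (bookkeeping)] -/
theorem continuous_bondPath (u : 𝔸ˣ) : Continuous fun t : ℝ => bondPath u t := by
  have h1 : Continuous fun t : ℝ => ((selfAdjoint.expUnitary (t • argSA u) : unitary 𝔸) : 𝔸) :=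
    continuous_subtype_val.comp (selfAdjoint.continuous_expUnitary.comp (continuous_id.smul continuous_const))
  refine Units.continuous_iff.2 ⟨h1, ?_⟩
  simpa only [val_inv_bondPath] using h1.star

/-- ★ **NO BOND MOVES AWAY FROM `1` ALONG THE RADIAL PATH**: `‖e^{it·arg u} − 1‖ ≤ ‖u − 1‖` for `t ∈ [0, 1]`, `u` unitary with `‖u − 1‖ < 2` — Mathlib's sharp
cosine identity `‖e^{ix} − 1‖² = 2(1 − cos ‖x‖)` (`Unitary.norm_expUnitary_smul_argSelfAdjoint_sub_one_le`). [cite: Balaban1985Averaging, (24) p.21; Balaban1985BackgroundPropagators, (3.36) p.396] -/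
theorem norm_bondPath_sub_one_le {u : 𝔸ˣ} (hu : u ∈ unitaryUnits 𝔸) (h2 : ‖(u : 𝔸) - 1‖ < 2) {t : ℝ} (ht : t ∈ Set.Icc (0 : ℝ) 1) :
    ‖((bondPath u t : 𝔸ˣ) : 𝔸) - 1‖ ≤ ‖(u : 𝔸) - 1‖ := by
  rw [val_bondPath, argSA_eq hu]
  exact Unitary.norm_expUnitary_smul_argSelfAdjoint_sub_one_le ⟨(u : 𝔸), hu⟩ ht h2

/-- **LINEAR-IN-TIME BOUND**: `‖e^{it·arg u} − 1‖ ≤ |t|·‖arg u‖` for every unit and every `t` ([5] (24) for the self-adjoint `t·arg u`).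
[cite: Balaban1985Averaging, (24) p.21] -/
theorem norm_bondPath_sub_one_le_mul (u : 𝔸ˣ) (t : ℝ) : ‖((bondPath u t : 𝔸ˣ) : 𝔸) - 1‖ ≤ |t| * ‖argSA u‖ := by
  have h := MatrixLog.norm_expUnitary_sub_one_le (t • argSA u)
  rw [val_bondPath]
  refine h.trans (le_of_eq ?_)
  rw [norm_smul, Real.norm_eq_abs]

/-- … hence `‖e^{it·arg u} − 1‖ ≤ |t|·(π∕2)·‖u − 1‖` for a unitary-valued unit with `‖u − 1‖ < 2`. [cite: Balaban1985Averaging, (24)–(25) p.21] -/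
theorem norm_bondPath_sub_one_le_mul' {u : 𝔸ˣ} (hu : u ∈ unitaryUnits 𝔸) (h2 : ‖(u : 𝔸) - 1‖ < 2) (t : ℝ) :
    ‖((bondPath u t : 𝔸ˣ) : 𝔸) - 1‖ ≤ |t| * (π / 2 * ‖(u : 𝔸) - 1‖) :=
  (norm_bondPath_sub_one_le_mul u t).trans (mul_le_mul_of_nonneg_left (norm_argSA_le hu h2) (abs_nonneg t))

end OneBond

/-! ## §2  Configurations on `ℤᵈ`: the bondwise radial path, its bonds and its plaquettes -/

section Config

variable {d : ℕ}

/-- **THE RADIAL PATH OF A BACKGROUND**: bond by bond, `U_t(b) = e^{it·arg U(b)}`. [cite: Balaban1985BackgroundPropagators, (3.36) p.396, Thm 3.11 p.416] -/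
def cfgPath (U : Site d → Fin d → 𝔸ˣ) (t : ℝ) : Site d → Fin d → 𝔸ˣ := fun x κ => bondPath (U x κ) t

/-- the radial path, unfolded at a bond. [cite: Balaban1985BackgroundPropagators, (3.36) p.396 (bookkeeping)] -/
theorem cfgPath_apply (U : Site d → Fin d → 𝔸ˣ) (t : ℝ) (x : Site d) (κ : Fin d) : cfgPath U t x κ = bondPath (U x κ) t := rfl

/-- it starts at the flat background. [cite: Balaban1985BackgroundPropagators, Thm 3.11 p.416 («G_□(1) is positive»)] -/
theorem cfgPath_zero (U : Site d → Fin d → 𝔸ˣ) : cfgPath U 0 = 1 := by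
  funext x κ
  rw [cfgPath_apply, bondPath_zero, Pi.one_apply, Pi.one_apply]

/-- it ends at `U` when `U` is unitary-valued with every bond variable within `2` of `1`. [cite: Balaban1985BackgroundPropagators, (3.36) p.396] -/
theorem cfgPath_one {U : Site d → Fin d → 𝔸ˣ} (hU : ∀ x κ, U x κ ∈ unitaryUnits 𝔸) (h2 : ∀ x κ, ‖((U x κ : 𝔸ˣ) : 𝔸) - 1‖ < 2) :
    cfgPath U 1 = U := by
  funext x κ
  rw [cfgPath_apply, bondPath_one (hU x κ) (h2 x κ)]

/-- every background on the radial path is unitary-valued. [cite: Balaban1985BackgroundPropagators, (3.35)–(3.36) p.396] -/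
theorem cfgPath_mem_unitaryUnits (U : Site d → Fin d → 𝔸ˣ) (t : ℝ) (x : Site d) (κ : Fin d) : cfgPath U t x κ ∈ unitaryUnits 𝔸 :=
  bondPath_mem_unitaryUnits _ _

/-- the radial path is continuous in `t` for the product topology on `ℤᵈ × {directions} → 𝔸ˣ`. [cite: Balaban1985BackgroundPropagators, (3.36) p.396 (bookkeeping)] -/
theorem continuous_cfgPath (U : Site d → Fin d → 𝔸ˣ) : Continuous fun t : ℝ => cfgPath U t :=
  continuous_pi fun x => continuous_pi fun κ => continuous_bondPath (U x κ)

/-- ★ **NO BOND VARIABLE MOVES AWAY FROM `1` ALONG THE RADIAL PATH** (`t ∈ [0, 1]`, the bond unitary and within `2` of `1`). [cite: Balaban1985Averaging, (24) p.21; Balaban1985BackgroundPropagators, (3.36) p.396] -/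
theorem norm_cfgPath_sub_one_le {U : Site d → Fin d → 𝔸ˣ} {x : Site d} {κ : Fin d} (hU : U x κ ∈ unitaryUnits 𝔸)
    (h2 : ‖((U x κ : 𝔸ˣ) : 𝔸) - 1‖ < 2) {t : ℝ} (ht : t ∈ Set.Icc (0 : ℝ) 1) :
    ‖((cfgPath U t x κ : 𝔸ˣ) : 𝔸) - 1‖ ≤ ‖((U x κ : 𝔸ˣ) : 𝔸) - 1‖ :=
  norm_bondPath_sub_one_le hU h2 ht

variable [Nontrivial 𝔸]

/-- ★ **EVERY PLAQUETTE STAYS `4ε`-CLOSE TO `1` ALONG THE RADIAL PATH** of a unitary background whose bond variables are `ε`-close to `1` (`ε < 2`, `t ∈ [0, 1]`;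
dag-n06-w2's four-bond telescoping `norm_plaqF_sub_one_le` at the background `U_t`). [cite: Balaban1985RegularSpaces, (1.7) p.77; Balaban1985BackgroundPropagators, (3.35)–(3.36) p.396] -/
theorem norm_plaqF_cfgPath_sub_one_le {U : Site d → Fin d → 𝔸ˣ} (hU : ∀ x κ, U x κ ∈ unitaryUnits 𝔸) {ε : ℝ}
    (hε : ∀ x κ, ‖((U x κ : 𝔸ˣ) : 𝔸) - 1‖ ≤ ε) (hε2 : ε < 2) {t : ℝ} (ht : t ∈ Set.Icc (0 : ℝ) 1) (μ ν : Fin d) (x : Site d) :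
    ‖plaqF (cfgPath U t) μ ν x - 1‖ ≤ 4 * ε :=
  norm_plaqF_sub_one_le (fun y κ => unitaryUnits_le_U1 (cfgPath_mem_unitaryUnits U t y κ))
    (fun y κ => (norm_cfgPath_sub_one_le (hU y κ) ((hε y κ).trans_lt hε2) ht).trans (hε y κ)) μ ν x

/-- … so the whole radial path lies in the class (1.7) on ALL of `ℤᵈ` up to level `m` at window `α` as soon as `4ε < αL^{−2m}` (`L ≥ 1`).
[cite: Balaban1985RegularSpaces, (1.7) p.77] -/
theorem reg17Univ_cfgPath {L : ℕ} (hL : 1 ≤ L) (m : ℕ) {U : Site d → Fin d → 𝔸ˣ} (hU : ∀ x κ, U x κ ∈ unitaryUnits 𝔸) {α ε : ℝ}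
    (hε : ∀ x κ, ‖((U x κ : 𝔸ˣ) : 𝔸) - 1‖ ≤ ε) (hε2 : ε < 2) (hα : 4 * ε < α * (((L : ℝ) ^ m)⁻¹) ^ 2) {t : ℝ} (ht : t ∈ Set.Icc (0 : ℝ) 1) :
    Reg17 L m (fun _ => (Set.univ : Set (Site d))) α (cfgPath U t) :=
  reg17Univ_of_bond_close hL m (fun y κ => unitaryUnits_le_U1 (cfgPath_mem_unitaryUnits U t y κ))
    (fun y κ => (norm_cfgPath_sub_one_le (hU y κ) ((hε y κ).trans_lt hε2) ht).trans (hε y κ)) hα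

end Config

/-! ## §3  The uniform balls of unitary backgrounds around `1` are star-shaped along the radial paths, hence path connected -/

section Ball

variable {d : ℕ}

omit [CStarAlgebra 𝔸] in
/-- the flat background lies in every uniform ball of positive radius. [cite: Balaban1985BackgroundPropagators, Thm 3.11 p.416 (bookkeeping)] -/
theorem one_mem_ball {𝔸 : Type*} [CStarAlgebra 𝔸] {δ : ℝ} (hδ : 0 < δ) :
    (1 : Site d → Fin d → 𝔸ˣ) ∈ {U : Site d → Fin d → 𝔸ˣ | (∀ x κ, U x κ ∈ unitaryUnits 𝔸) ∧ ∀ x κ, ‖((U x κ : 𝔸ˣ) : 𝔸) - 1‖ < δ} := by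
  refine ⟨fun x κ => Subgroup.one_mem _, fun x κ => ?_⟩
  rw [Pi.one_apply, Pi.one_apply, Units.val_one, sub_self, norm_zero]
  exact hδ

/-- ★ **THE RADIAL PATH OF A POINT OF THE `δ`-BALL STAYS IN THE `δ`-BALL** (`δ ≤ 2`, `t ∈ [0, 1]`). [cite: Balaban1985BackgroundPropagators, (3.36) p.396] -/
theorem cfgPath_mem_ball {δ : ℝ} (hδ2 : δ ≤ 2) {U : Site d → Fin d → 𝔸ˣ}
    (hU : U ∈ {U : Site d → Fin d → 𝔸ˣ | (∀ x κ, U x κ ∈ unitaryUnits 𝔸) ∧ ∀ x κ, ‖((U x κ : 𝔸ˣ) : 𝔸) - 1‖ < δ})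
    {t : ℝ} (ht : t ∈ Set.Icc (0 : ℝ) 1) :
    cfgPath U t ∈ {U : Site d → Fin d → 𝔸ˣ | (∀ x κ, U x κ ∈ unitaryUnits 𝔸) ∧ ∀ x κ, ‖((U x κ : 𝔸ˣ) : 𝔸) - 1‖ < δ} :=
  ⟨fun x κ => cfgPath_mem_unitaryUnits U t x κ,
    fun x κ => (norm_cfgPath_sub_one_le (hU.1 x κ) ((hU.2 x κ).trans_le hδ2) ht).trans_lt (hU.2 x κ)⟩

/-- ★★ **EVERY POINT OF THE `δ`-BALL IS JOINED TO THE FLAT BACKGROUND INSIDE THE `δ`-BALL** by its radial path (`δ ≤ 2`).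
[cite: Balaban1985BackgroundPropagators, Thm 3.11 p.416, (3.36) p.396] -/
theorem joinedIn_ball_one {δ : ℝ} (hδ2 : δ ≤ 2) {U : Site d → Fin d → 𝔸ˣ}
    (hU : U ∈ {U : Site d → Fin d → 𝔸ˣ | (∀ x κ, U x κ ∈ unitaryUnits 𝔸) ∧ ∀ x κ, ‖((U x κ : 𝔸ˣ) : 𝔸) - 1‖ < δ}) :
    JoinedIn {U : Site d → Fin d → 𝔸ˣ | (∀ x κ, U x κ ∈ unitaryUnits 𝔸) ∧ ∀ x κ, ‖((U x κ : 𝔸ˣ) : 𝔸) - 1‖ < δ} 1 U := by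
  refine JoinedIn.ofLine (continuous_cfgPath U).continuousOn (cfgPath_zero U)
    (cfgPath_one hU.1 fun x κ => (hU.2 x κ).trans_le hδ2) ?_
  rintro _ ⟨t, ht, rfl⟩
  exact cfgPath_mem_ball hδ2 hU ht

/-- ★★ **THE UNIFORM `δ`-BALL OF UNITARY BACKGROUNDS AROUND `1` IS PATH CONNECTED** (`0 < δ ≤ 2`; product topology).
[cite: Balaban1985BackgroundPropagators, Thm 3.11 p.416, (3.36) p.396] -/
theorem isPathConnected_ball {δ : ℝ} (hδ0 : 0 < δ) (hδ2 : δ ≤ 2) :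
    IsPathConnected {U : Site d → Fin d → 𝔸ˣ | (∀ x κ, U x κ ∈ unitaryUnits 𝔸) ∧ ∀ x κ, ‖((U x κ : 𝔸ˣ) : 𝔸) - 1‖ < δ} :=
  ⟨1, one_mem_ball hδ0, fun _ hU => joinedIn_ball_one hδ2 hU⟩

/-- … hence PRECONNECTED — the shape of the family hypothesis of the continuity-method reduction. [cite: Balaban1985BackgroundPropagators, Thm 3.11 p.416] -/
theorem isPreconnected_ball {δ : ℝ} (hδ0 : 0 < δ) (hδ2 : δ ≤ 2) :
    IsPreconnected {U : Site d → Fin d → 𝔸ˣ | (∀ x κ, U x κ ∈ unitaryUnits 𝔸) ∧ ∀ x κ, ‖((U x κ : 𝔸ˣ) : 𝔸) - 1‖ < δ} :=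
  (isPathConnected_ball hδ0 hδ2).isConnected.isPreconnected

/-- ★ the CLOSED uniform ball (`‖U(b) − 1‖ ≤ δ` at every bond, `0 ≤ δ < 2`; dag-n06-w4 g4's compact class) is path connected too, by the same radial paths.
[cite: Balaban1985BackgroundPropagators, (3.35)–(3.36) p.396] -/
theorem isPathConnected_closedBall {δ : ℝ} (hδ0 : 0 ≤ δ) (hδ2 : δ < 2) :
    IsPathConnected {U : Site d → Fin d → 𝔸ˣ | (∀ x κ, U x κ ∈ unitaryUnits 𝔸) ∧ ∀ x κ, ‖((U x κ : 𝔸ˣ) : 𝔸) - 1‖ ≤ δ} := by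
  refine ⟨1, ⟨fun x κ => Subgroup.one_mem _, fun x κ => ?_⟩, fun U hU => ?_⟩
  · rw [Pi.one_apply, Pi.one_apply, Units.val_one, sub_self, norm_zero]
    exact hδ0
  · refine JoinedIn.ofLine (continuous_cfgPath U).continuousOn (cfgPath_zero U)
      (cfgPath_one hU.1 fun x κ => (hU.2 x κ).trans_lt hδ2) ?_
    rintro _ ⟨t, ht, rfl⟩
    exact ⟨fun x κ => cfgPath_mem_unitaryUnits U t x κ,
      fun x κ => (norm_cfgPath_sub_one_le (hU.1 x κ) ((hU.2 x κ).trans_lt hδ2) ht).trans (hU.2 x κ)⟩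

end Ball

/-! ## §4  Gauge translates: the uniform balls around every PURE GAUGE `1^w` ((3.36)'s shape «U^u = e^{iηA}, |A| small») -/

section Gauge

variable {d : ℕ}

open B9Eq336PureGaugeOrbitZd (continuous_gaugeAct)
open B9Eq333ProjectionCovarianceZd (gaugeAct_inv_gaugeAct)
open B9Eq332AveragingLetterCovarianceZd (reg17_gaugeAct_iff)

omit [CStarAlgebra 𝔸] in
/-- membership in a gauge translate: `U ∈ (S)^w ↔ U^{w⁻¹} ∈ S`. [cite: Balaban1985BackgroundPropagators, (3.28) p.395 (bookkeeping)] -/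
theorem mem_gaugeAct_image_iff {𝔸 : Type*} [Monoid 𝔸] (w : Site d → 𝔸ˣ) (S : Set (Site d → Fin d → 𝔸ˣ)) (U : Site d → Fin d → 𝔸ˣ) :
    U ∈ (fun V => gaugeAct w V) '' S ↔ gaugeAct w⁻¹ U ∈ S := by
  constructor
  · rintro ⟨V, hV, rfl⟩
    rwa [gaugeAct_inv_gaugeAct]
  · intro h
    refine ⟨gaugeAct w⁻¹ U, h, ?_⟩
    have h1 := gaugeAct_inv_gaugeAct w⁻¹ U
    rwa [inv_inv] at h1

/-- the gauge translate of the radial path starts at the PURE GAUGE `1^w`. [cite: Balaban1985BackgroundPropagators, (3.36) p.396] -/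
theorem gaugeAct_cfgPath_zero (w : Site d → 𝔸ˣ) (U : Site d → Fin d → 𝔸ˣ) : gaugeAct w (cfgPath U 0) = gaugeAct w 1 := by
  rw [cfgPath_zero]

/-- … and ends at `U^w`. [cite: Balaban1985BackgroundPropagators, (3.36) p.396] -/
theorem gaugeAct_cfgPath_one (w : Site d → 𝔸ˣ) {U : Site d → Fin d → 𝔸ˣ} (hU : ∀ x κ, U x κ ∈ unitaryUnits 𝔸)
    (h2 : ∀ x κ, ‖((U x κ : 𝔸ˣ) : 𝔸) - 1‖ < 2) : gaugeAct w (cfgPath U 1) = gaugeAct w U := by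
  rw [cfgPath_one hU h2]

/-- the gauge-translated radial path is continuous. [cite: Balaban1985BackgroundPropagators, (3.28) p.395, (3.36) p.396 (bookkeeping)] -/
theorem continuous_gaugeAct_cfgPath (w : Site d → 𝔸ˣ) (U : Site d → Fin d → 𝔸ˣ) : Continuous fun t : ℝ => gaugeAct w (cfgPath U t) :=
  (continuous_gaugeAct w).comp (continuous_cfgPath U)

/-- the plaquette variables of the gauge-translated radial path are those of the radial path up to conjugation AT THE BASE POINT — `4ε`-close to `1` for a
`U1`-valued gauge (`‖w(x)‖, ‖w(x)⁻¹‖ ≤ 1`). [cite: Balaban1985Averaging, (45) p.24; Balaban1985RegularSpaces, (1.7) p.77] -/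
theorem norm_plaqF_gaugeAct_cfgPath_sub_one_le [Nontrivial 𝔸] {w : Site d → 𝔸ˣ} (hw : ∀ z, w z ∈ U1 𝔸) {U : Site d → Fin d → 𝔸ˣ}
    (hU : ∀ x κ, U x κ ∈ unitaryUnits 𝔸) {ε : ℝ} (hε : ∀ x κ, ‖((U x κ : 𝔸ˣ) : 𝔸) - 1‖ ≤ ε) (hε2 : ε < 2) {t : ℝ} (ht : t ∈ Set.Icc (0 : ℝ) 1)
    (μ ν : Fin d) (x : Site d) : ‖plaqF (gaugeAct w (cfgPath U t)) μ ν x - 1‖ ≤ 4 * ε := by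
  have h1 : conjR (w x) (plaqF (cfgPath U t) μ ν x) - 1 = conjR (w x) (plaqF (cfgPath U t) μ ν x - 1) := by rw [conjR_sub, conjR_one]
  rw [plaqF_gaugeAct, h1, norm_conjR (hw x)]
  exact norm_plaqF_cfgPath_sub_one_le hU hε hε2 ht μ ν x

/-- the pure gauge `1^w` lies in the gauge translate of every ball of positive radius. [cite: Balaban1985BackgroundPropagators, (3.36) p.396 (bookkeeping)] -/
theorem gaugeAct_one_mem_image_ball (w : Site d → 𝔸ˣ) {δ : ℝ} (hδ0 : 0 < δ) :
    gaugeAct w 1 ∈ (fun V => gaugeAct w V) ''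
      {U : Site d → Fin d → 𝔸ˣ | (∀ x κ, U x κ ∈ unitaryUnits 𝔸) ∧ ∀ x κ, ‖((U x κ : 𝔸ˣ) : 𝔸) - 1‖ < δ} :=
  ⟨1, one_mem_ball hδ0, rfl⟩

/-- `U^w` lies in the gauge translate of the `δ`-ball when `U` lies in the `δ`-ball. [cite: Balaban1985BackgroundPropagators, (3.36) p.396 (bookkeeping)] -/
theorem gaugeAct_mem_image_ball (w : Site d → 𝔸ˣ) {δ : ℝ} {U : Site d → Fin d → 𝔸ˣ}
    (hU : U ∈ {U : Site d → Fin d → 𝔸ˣ | (∀ x κ, U x κ ∈ unitaryUnits 𝔸) ∧ ∀ x κ, ‖((U x κ : 𝔸ˣ) : 𝔸) - 1‖ < δ}) :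
    gaugeAct w U ∈ (fun V => gaugeAct w V) ''
      {U : Site d → Fin d → 𝔸ˣ | (∀ x κ, U x κ ∈ unitaryUnits 𝔸) ∧ ∀ x κ, ‖((U x κ : 𝔸ˣ) : 𝔸) - 1‖ < δ} :=
  ⟨U, hU, rfl⟩

/-- ★★ **EVERY POINT OF THE TRANSLATED BALL IS JOINED TO THE PURE GAUGE `1^w` INSIDE THE TRANSLATED BALL** (`δ ≤ 2`), by the translated radial path.
[cite: Balaban1985BackgroundPropagators, Thm 3.11 p.416, (3.36) p.396] -/
theorem joinedIn_image_ball_gaugeAct_one (w : Site d → 𝔸ˣ) {δ : ℝ} (hδ2 : δ ≤ 2) {U : Site d → Fin d → 𝔸ˣ}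
    (hU : U ∈ {U : Site d → Fin d → 𝔸ˣ | (∀ x κ, U x κ ∈ unitaryUnits 𝔸) ∧ ∀ x κ, ‖((U x κ : 𝔸ˣ) : 𝔸) - 1‖ < δ}) :
    JoinedIn ((fun V => gaugeAct w V) ''
      {U : Site d → Fin d → 𝔸ˣ | (∀ x κ, U x κ ∈ unitaryUnits 𝔸) ∧ ∀ x κ, ‖((U x κ : 𝔸ˣ) : 𝔸) - 1‖ < δ}) (gaugeAct w 1) (gaugeAct w U) := by
  refine JoinedIn.ofLine (continuous_gaugeAct_cfgPath w U).continuousOn (gaugeAct_cfgPath_zero w U)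
    (gaugeAct_cfgPath_one w hU.1 fun x κ => (hU.2 x κ).trans_le hδ2) ?_
  rintro _ ⟨t, ht, rfl⟩
  exact ⟨cfgPath U t, cfgPath_mem_ball hδ2 hU ht, rfl⟩

/-- ★★ **THE GAUGE TRANSLATE OF THE `δ`-BALL AROUND EVERY PURE GAUGE IS PATH CONNECTED** (`0 < δ ≤ 2`; the image of a path-connected set under the
homeomorphism `U ↦ U^w` of `B9Eq336PureGaugeOrbitZd`). [cite: Balaban1985BackgroundPropagators, Thm 3.11 p.416, (3.36) p.396] -/
theorem isPathConnected_image_ball (w : Site d → 𝔸ˣ) {δ : ℝ} (hδ0 : 0 < δ) (hδ2 : δ ≤ 2) :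
    IsPathConnected ((fun V => gaugeAct w V) ''
      {U : Site d → Fin d → 𝔸ˣ | (∀ x κ, U x κ ∈ unitaryUnits 𝔸) ∧ ∀ x κ, ‖((U x κ : 𝔸ˣ) : 𝔸) - 1‖ < δ}) :=
  (isPathConnected_ball hδ0 hδ2).image (continuous_gaugeAct w)

/-- … hence preconnected. [cite: Balaban1985BackgroundPropagators, Thm 3.11 p.416] -/
theorem isPreconnected_image_ball (w : Site d → 𝔸ˣ) {δ : ℝ} (hδ0 : 0 < δ) (hδ2 : δ ≤ 2) :
    IsPreconnected ((fun V => gaugeAct w V) ''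
      {U : Site d → Fin d → 𝔸ˣ | (∀ x κ, U x κ ∈ unitaryUnits 𝔸) ∧ ∀ x κ, ‖((U x κ : 𝔸ˣ) : 𝔸) - 1‖ < δ}) :=
  (isPathConnected_image_ball w hδ0 hδ2).isConnected.isPreconnected

/-- ★★ **THE TRANSLATED BALL LIES IN THE REGIME `𝒰′`** (`w` unitary, `4δ < (α_Q∕L²)L^{−2m}`): unitarity is preserved by a unitary gauge and the class (1.7) on `ℤᵈ`
is gauge invariant (`reg17_gaugeAct_iff`); the ball itself is dag-n06-w2's `ball_subset_reg17UnivP`. [cite: Balaban1985RegularSpaces, (1.7) p.77 («𝔄 is invariant with respect to gauge transformations»); Balaban1985BackgroundPropagators, (3.36) p.396] -/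
theorem image_ball_subset_reg17UnivP [Nontrivial 𝔸] {L : ℕ} (hL : 1 ≤ L) (m : ℕ) {δ : ℝ}
    (hδ : 4 * δ < alphaQ d L / (L : ℝ) ^ 2 * (((L : ℝ) ^ m)⁻¹) ^ 2) {w : Site d → 𝔸ˣ} (hw : ∀ z, w z ∈ unitaryUnits 𝔸) :
    (fun V => gaugeAct w V) '' {U : Site d → Fin d → 𝔸ˣ | (∀ x κ, U x κ ∈ unitaryUnits 𝔸) ∧ ∀ x κ, ‖((U x κ : 𝔸ˣ) : 𝔸) - 1‖ < δ} ⊆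
      {U₀ : Site d → Fin d → 𝔸ˣ | (∀ x κ, U₀ x κ ∈ unitaryUnits 𝔸) ∧
        Reg17 L m (fun _ => (Set.univ : Set (Site d))) (alphaQ d L / (L : ℝ) ^ 2) U₀} := by
  rintro _ ⟨V, hV, rfl⟩
  have hV' := ball_subset_reg17UnivP hL m hδ hV
  exact ⟨fun x κ => Subgroup.mul_mem _ (Subgroup.mul_mem _ (hw x) (hV'.1 x κ)) (Subgroup.inv_mem _ (hw _)),
    (reg17_gaugeAct_iff L m _ _ (fun z => unitaryUnits_le_U1 (hw z)) V).2 hV'.2⟩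

end Gauge

end Literature.MathematicalPhysics.QuantumFieldTheory.Balaban1983to89.B9Thm311SmallFieldPathZd

end
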